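import Summits.Ventures.HodgeRepro2.T5SU11KFiniteMajorant

/-!
# The sharpened majorant `|⟨π_k(g) zᵐ, zⁿ⟩_k| ≤ C_{m,n} ⟨zⁿ,zⁿ⟩_k · Ξ(g)^k`, and the positivity and
`k = 2` range of the spherical integrals

`T5SU11SphericalMajorant` gives `|a(g)|⁻¹ ≤ Ξ(g)`, so the decay `|a(g)|^{-k}` of every `K`-finite
coefficient (`T5BergmanKTypeMatrix`) is dominated by `Ξ(g)^k`, not merely by `Ξ(g)`:
**`|⟨π_k(g) zᵐ, zⁿ⟩_k| ≤ C_{m,n} ⟨zⁿ,zⁿ⟩_k · Ξ(g)^k`** for `k ≥ 2` (`norm_matrixCoeff_le_sph_one_pow`) —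
the coefficients of the weight-`k` discrete series decay like the `k`-th power of Harish-Chandra's `Ξ`
(since `Ξ ≤ 1`, this refines the majorant `Ξ` of `T5SU11KFiniteMajorant`). The Jacobi transform of
`m_k` is strictly positive on its strip (`jacobi_pos`), and the `Ξ`-integrability of the coefficients of
`T5SU11KFiniteMajorant` extends to the weight `k = 2` (`integrable_norm_matrixCoeff_two_mul_sph`:
`|⟨π_2(·) zᵐ, zⁿ⟩_2| φ_λ ∈ L¹(ν)` for `0 < λ < 2`). Nothing is claimed about (N).

Blind lane: Mathlib + the HodgeRepro2 prefix only; no sorry; axioms ⊆ {propext, Classical.choice,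
Quot.sound}.
-/

namespace Summit.Ventures.HodgeRepro2.T5SU11KFiniteMajorantPow

open MeasureTheory MeasureTheory.Measure Metric Set Filter Topology
open T5SU11Unimodular T5SU11Fibration T5SU11Cartan T5SU11CartanProjection T5HaarCircle
  T5BergmanCoefficient T5SU11FibrationHaar T5BergmanMatrixCoeff T5BergmanKTypeMatrix
  T5BergmanParseval T5BergmanCoefficientLpAll T5SU11SphericalFunction T5SU11SphericalBounds
  T5SU11SphericalContinuous T5SU11SphericalMajorant T5SU11JacobiIwasawa T5SU11JacobiTransform
  T5SU11KFiniteMajorant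
open scoped Real

section measure

variable [MeasurableSpace Circle] [BorelSpace Circle]

/-- `|a(g)|^{-k} ≤ Ξ(g)^k` for natural `k` (from `|a(g)|⁻¹ ≤ Ξ(g)`, both sides nonnegative). -/
lemma norm_mat_inv_pow_le_sph_one_pow (k : ℕ) (g : SU11) : ‖mat g 0 0‖⁻¹ ^ k ≤ sph 1 g ^ k :=
  pow_le_pow_left₀ (inv_nonneg.mpr (norm_nonneg _)) (norm_mat_inv_le_sph_one g) k

/-- **THE SHARPENED MAJORANT**: `|⟨π_k(g) zᵐ, zⁿ⟩_k| ≤ C_{m,n} ⟨zⁿ,zⁿ⟩_k · Ξ(g)^k` for `k ≥ 2`. -/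
theorem norm_matrixCoeff_le_sph_one_pow (k : ℕ) (hk : 2 ≤ k) (g : SU11) (m n : ℕ) :
    ‖matrixCoeff k (fun z => z ^ m) (fun z => z ^ n) g‖ ≤
      decayConst k m n * monomialNormSq k n * sph 1 g ^ k := by
  refine (norm_matrixCoeff_monomial_monomial_le k hk g m n).trans ?_
  have hC : 0 ≤ decayConst k m n * monomialNormSq k n :=
    mul_nonneg (decayConst_nonneg k m n) (monomialNormSq_pos k n).le
  exact mul_le_mul_of_nonneg_left (norm_mat_inv_pow_le_sph_one_pow k g) hC

/-- `Ξ(g)^k ≤ Ξ(g)` for `k ≥ 1` (`0 < Ξ ≤ 1`): the sharpened majorant implies the majorant of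
`T5SU11KFiniteMajorant`. -/
lemma sph_one_pow_le_sph_one (k : ℕ) (hk : 1 ≤ k) (g : SU11) : sph 1 g ^ k ≤ sph 1 g := by
  have h0 := sph_pos 1 g
  have h1 := sph_le_one zero_le_one one_le_two g
  calc sph 1 g ^ k ≤ sph 1 g ^ 1 := pow_le_pow_of_le_one h0.le h1 hk
    _ = sph 1 g := pow_one _

/-- **Positivity of the Jacobi transform on its strip**: `0 < ∫_G m_k φ_λ dν` for `k > 1`, `λ < k`,
`k + λ > 2`. -/
theorem jacobi_pos {k lam : ℝ} (hk : 1 < k) (h1 : lam < k) (h2 : 2 < k + lam) :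
    0 < ∫ g, (1 - ‖orbit g‖ ^ 2) ^ (k / 2) * sph lam g ∂(nu haarCircle) := by
  rw [integral_orbit_rpow_mul_sph hk h1 h2]
  have g1 : 0 < Real.Gamma ((k - 1) / 2) := Real.Gamma_pos_of_pos (by linarith)
  have g2 : 0 < Real.Gamma (k / 2) := Real.Gamma_pos_of_pos (by linarith)
  have g3 : 0 < Real.Gamma ((k - lam) / 2) := Real.Gamma_pos_of_pos (by linarith)
  have g4 : 0 < Real.Gamma ((k + lam) / 2 - 1) := Real.Gamma_pos_of_pos (by linarith)
  have g5 : 0 < Real.Gamma (k - 1) := Real.Gamma_pos_of_pos (by linarith)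
  have g6 : (0 : ℝ) < 2 ^ (k - 2) := Real.rpow_pos_of_pos (by norm_num) _
  have hs : 0 < √π := Real.sqrt_pos.mpr Real.pi_pos
  positivity

/-- **The weight `k = 2`**: `|⟨π_2(·) zᵐ, zⁿ⟩_2| · φ_λ ∈ L¹(ν)` for `0 < λ < 2` (the `k = 2` case left out
of `T5SU11KFiniteMajorant`, whose bound holds for every `k ≥ 2`). -/
theorem integrable_norm_matrixCoeff_two_mul_sph {lam : ℝ} (h1 : 0 < lam) (h2 : lam < 2) (m n : ℕ) :
    Integrable (fun g => ‖matrixCoeff 2 (fun z => z ^ m) (fun z => z ^ n) g‖ * sph lam g)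
      (nu haarCircle) := by
  have hdom := (integrable_orbit_rpow_mul_sph (k := 2) (by norm_num) (by linarith) (by linarith))
    |>.const_mul (decayConst 2 m n * monomialNormSq 2 n)
  refine hdom.mono' ?_ (Filter.Eventually.of_forall fun g => ?_)
  · exact ((continuous_matrixCoeff_monomial_monomial 2 m n).norm.mul (continuous_sph lam))
      |>.aestronglyMeasurable
  · rw [Real.norm_eq_abs, abs_of_nonneg (mul_nonneg (norm_nonneg _) (sph_pos lam g).le), ← mul_assoc]
    have h := norm_matrixCoeff_le_orbit_rpow 2 le_rfl g m n
    rw [show ((2 : ℕ) : ℝ) / 2 = (2 : ℝ) / 2 by norm_num] at h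
    exact mul_le_mul_of_nonneg_right h (sph_pos lam g).le

end measure

end Summit.Ventures.HodgeRepro2.T5SU11KFiniteMajorantPow
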